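import Mathlib
import Summits.Ventures.PercRepro2.Sep2Fibres

/-!
# The unified o-shield `K = {x, a₁}`: conditional independence on the fibres and the `γ`-identity
(blind cell PercRepro2, night-1 g33; proofs/NIGHT1-G33.md §8; census mining/night-1/g33/check_mixed_sep.py,
check_mixed_sep2.py — 152/152)

Setting of Sep2Fibres: `IsSep2 ends x a₁ ↑VA ↑VB EA EB`, `o ∈ VA`, `a₂ ∈ VB`, `N = {x ↮_A a₁}`.
Across the separator the two sides are independent (`prob_side_mul`), so on a fibre `W ∌ a₁` the
`A`-side and `B`-side events are conditionally independent (`prob_fibre_inter_mul`: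
`P(fibre, X_A) P(fibre, Y_B) = P(fibre) P(fibre, X_A, Y_B)`), and the **`γ`-identity** holds:
`γ = P_A(N, a₁ ↔ o) / P_A(N)` (`gamma_eq`, for `D ≠ 0`) and `P(N × B', a₁ ↔ o) = γ · P(N × B')` for every
`B' ⊆ {x ↮_B a₁}` (`prob_class_conn_o`): the conditional probability that `o ↔ a₁` is the same `γ` on
every `B`-side event of the root classes without `a₁` — the mechanism of the shield.  Standard axioms.
-/

namespace Summit.Ventures.PercRepro2

open UnionCluster CovForm CutV Sep2

namespace CovForm

namespace A3Fibre

namespace Sep2Shield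

section Prob

variable {V : Type*} {E : Type*} [Fintype V] [DecidableEq V] [Fintype E] [DecidableEq E]
  {R : Type*} [Field R] [LinearOrder R] [IsStrictOrderedRing R] {ends : E → Sym2 V} {x a₁ : V}
  {VA VB : Finset V} {EA EB : Set E} [DecidablePred (· ∈ EA)] [DecidablePred (· ∈ EB)] {p : E → R}
  {o a₂ : V}

omit [Fintype V] [DecidableEq V] [LinearOrder R] [IsStrictOrderedRing R] in
/-- **Product law across the separator.** -/
lemma prob_side_mul (h : IsSep2 ends x a₁ ↑VA ↑VB EA EB) (A B : Set (Config E)) :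
    prob p (sideEvent EA A ∩ sideEvent EB B) = prob p (sideEvent EA A) * prob p (sideEvent EB B) :=
  prob_inter_eq_mul_of_dependsOn p h.Edisj (dependsOn_sideEvent EA A) (dependsOn_sideEvent EB B)

omit [Fintype V] [LinearOrder R] [IsStrictOrderedRing R] in
/-- **Conditional independence on a fibre `W ∌ a₁`**:
`P(fibre, X_A) · P(fibre, Y_B) = P(fibre) · P(fibre, X_A, Y_B)`. -/
lemma prob_fibre_inter_mul (h : IsSep2 ends x a₁ ↑VA ↑VB EA EB) (h2 : a₂ ∈ VB) {W : Finset V}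
    (ha1 : a₁ ∉ W) (X' Y' : Set (Config E)) :
    prob p (fibre ends a₁ a₂ x W ∩ sideEvent EA X') * prob p (fibre ends a₁ a₂ x W ∩ sideEvent EB Y') =
      prob p (fibre ends a₁ a₂ x W) *
        prob p (fibre ends a₁ a₂ x W ∩ (sideEvent EA X' ∩ sideEvent EB Y')) := by
  by_cases hW : W ⊆ insert x (VA ∪ VB)
  · rw [fibre_eq_prod h h2 ha1 hW]
    generalize clusterEvent ends x ↑(W.filter (· ∈ insert x VA)) = FA
    generalize clusterEvent ends x ↑(W.filter (· ∈ insert x VB)) ∩ avoidAll ends a₂ {a₁} = FB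
    have e1 : sideEvent EA FA ∩ sideEvent EB FB ∩ sideEvent EA X' =
        sideEvent EA (FA ∩ X') ∩ sideEvent EB FB := by
      ext ω; simp only [Set.mem_inter_iff, mem_sideEvent]; tauto
    have e2 : sideEvent EA FA ∩ sideEvent EB FB ∩ sideEvent EB Y' =
        sideEvent EA FA ∩ sideEvent EB (FB ∩ Y') := by
      ext ω; simp only [Set.mem_inter_iff, mem_sideEvent]; tauto
    have e3 : sideEvent EA FA ∩ sideEvent EB FB ∩ (sideEvent EA X' ∩ sideEvent EB Y') =
        sideEvent EA (FA ∩ X') ∩ sideEvent EB (FB ∩ Y') := by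
      ext ω; simp only [Set.mem_inter_iff, mem_sideEvent]; tauto
    rw [e1, e2, e3, prob_side_mul h, prob_side_mul h, prob_side_mul h, prob_side_mul h]
    ring
  · rw [fibre_eq_empty_of_not_subset h ha1 hW]
    simp

omit [Fintype V] [DecidableEq V] [LinearOrder R] [IsStrictOrderedRing R] in
/-- `P(N × B', a₁ ↔ o) = P_A(N, a₁ ↔ o) · P_B(B')` for `B' ⊆ {x ↮_B a₁}`. -/
lemma prob_N_inter_conn_o (h : IsSep2 ends x a₁ ↑VA ↑VB EA EB) (ho : o ∈ VA)
    {B' : Set (Config E)} (hB' : B' ⊆ (connEvent ends x a₁)ᶜ) :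
    prob p (sideEvent EA (connEvent ends x a₁)ᶜ ∩ sideEvent EB B' ∩ connEvent ends a₁ o) =
      prob p (sideEvent EA ((connEvent ends x a₁)ᶜ ∩ connEvent ends a₁ o)) *
        prob p (sideEvent EB B') := by
  rw [N_inter_conn_o h ho hB', prob_side_mul h]

omit [Fintype V] [DecidableEq V] [LinearOrder R] [IsStrictOrderedRing R] in
/-- `γ = P_A(N, a₁ ↔ o) / P_A(N)` when `D ≠ 0`. -/
lemma gamma_eq (h : IsSep2 ends x a₁ ↑VA ↑VB EA EB) (ho : o ∈ VA) (h2 : a₂ ∈ VB)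
    (hD : prob p (PDEvent ends a₁ a₂ x) ≠ 0) :
    gamma p ends o a₁ a₂ x =
      prob p (sideEvent EA ((connEvent ends x a₁)ᶜ ∩ connEvent ends a₁ o)) /
        prob p (sideEvent EA (connEvent ends x a₁)ᶜ) := by
  have hPD := PDEvent_eq_prod h h2
  have hsub : (connEvent ends x a₁)ᶜ ∩ (connEvent ends x a₂)ᶜ ∩ (connEvent ends a₁ a₂)ᶜ ⊆
      (connEvent ends x a₁)ᶜ := fun ω hω => hω.1.1
  have hD' : prob p (PDEvent ends a₁ a₂ x) = prob p (sideEvent EA (connEvent ends x a₁)ᶜ) *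
      prob p (sideEvent EB ((connEvent ends x a₁)ᶜ ∩ (connEvent ends x a₂)ᶜ ∩
        (connEvent ends a₁ a₂)ᶜ)) := by
    rw [hPD, prob_side_mul h]
  have hDo : PDEvent ends a₁ a₂ x ∩ connEvent ends a₂ o = ∅ := by
    ext ω
    simp only [PDEvent, Dtilde, UnionCluster.inU, Set.mem_inter_iff, mem_connEvent, Set.mem_compl_iff,
      Set.mem_union, not_or, Set.mem_empty_iff_false, iff_false, not_and]
    rintro ⟨hQ, hx1, hx2⟩ hc
    rcases conn_cross h (Finset.mem_coe.2 ho) (Finset.mem_coe.2 h2) (conn_symm hc) with hox | hoa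
    · exact hx2 (conn_symm (conn_trans hc hox))
    · exact hQ (conn_symm (conn_trans hc hoa))
  have hA : prob p (sideEvent EA (connEvent ends x a₁)ᶜ) ≠ 0 := by
    intro h0
    apply hD
    rw [hD', h0, zero_mul]
  have hB : prob p (sideEvent EB ((connEvent ends x a₁)ᶜ ∩ (connEvent ends x a₂)ᶜ ∩
      (connEvent ends a₁ a₂)ᶜ)) ≠ 0 := by
    intro h0
    apply hD
    rw [hD', h0, mul_zero]
  unfold gamma Do
  rw [hDo, prob_empty, add_zero, hPD, prob_N_inter_conn_o h ho hsub, prob_side_mul h]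
  field_simp

omit [Fintype V] [DecidableEq V] [LinearOrder R] [IsStrictOrderedRing R] in
/-- **The `γ`-identity**: on every product `N × B'` with `B' ⊆ {x ↮_B a₁}`,
`P(N × B', a₁ ↔ o) = γ · P(N × B')`. -/
lemma prob_class_conn_o (h : IsSep2 ends x a₁ ↑VA ↑VB EA EB) (ho : o ∈ VA) (h2 : a₂ ∈ VB)
    (hD : prob p (PDEvent ends a₁ a₂ x) ≠ 0) {B' : Set (Config E)}
    (hB' : B' ⊆ (connEvent ends x a₁)ᶜ) :
    prob p (sideEvent EA (connEvent ends x a₁)ᶜ ∩ sideEvent EB B' ∩ connEvent ends a₁ o) =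
      gamma p ends o a₁ a₂ x * prob p (sideEvent EA (connEvent ends x a₁)ᶜ ∩ sideEvent EB B') := by
  have hA : prob p (sideEvent EA (connEvent ends x a₁)ᶜ) ≠ 0 := by
    intro h0
    apply hD
    rw [PDEvent_eq_prod h h2, prob_side_mul h, h0, zero_mul]
  rw [prob_N_inter_conn_o h ho hB', gamma_eq h ho h2 hD, prob_side_mul h]
  field_simp

end Prob

end Sep2Shield

end A3Fibre

end CovForm

end Summit.Ventures.PercRepro2
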